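import Literature.AlgebraicGeometry.Resolution.BlowupsFlatBaseChange
import HarnessLib

/-!
# ADMISSIBILITY of the local centres: the regular locus of `Spec 𝒪_{X,x}` pulls back from `X`, so a centre supported in `Sing X` base-changes to a
# centre supported in `Sing (Spec 𝒪_{X,x})` (crux `FInjectiveMacaulayfication` stmt-ResolutionOfSingularities-15315, chain w45a; res-L1-w45a-plan-1
# RULING R17.8 «AD» (AD2-0): the transport lemma shared by the «E1-adm» induction and res-L1-w45a-stub-2's (AD1) engine; seat res-L1-w45a-stub-3 g7)

[OURS · L1 W4.5a] Support file (`--supports stmt-ResolutionOfSingularities-15315 --as helper`); NOT a statement of any manuscript; def-free, unconditional;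
AI-written (AI review is weaker than expert review).

* `mem_regularLocus_Spec_stalk_iff` — a point `s` of `Spec 𝒪_{X,x}` is regular iff its image `X.fromSpecStalk x s ∈ X` is: `fromSpecStalk` is a flat
  preimmersion, so its stalk maps are isomorphisms (Literature `mem_regularLocus_iff_of_flat_of_isPreimmersion`, `flat_fromSpecStalk`).
* **`support_comap_fromSpecStalk_subset`** — if `Supp J ⊆ (Reg X)ᶜ` then `Supp (J|_{Spec 𝒪_{X,x}}) ⊆ (Reg (Spec 𝒪_{X,x}))ᶜ` (Mathlib `support_comap`):
  the ADMISSIBILITY predicate `((I.support : Set _) ⊆ (Scheme.regularLocus (Spec (X.presheaf.stalk x)))ᶜ)` of programme «AD» for the base-changed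
  centre `I := J.comap (X.fromSpecStalk x)` of THEOREM A-gen's running model.
[folklore; cite: Temkin2008, §2.1 (pro-open pro-subschemes); Prop. 2.3.4 (iii)] [cite: StacksProject, Tag 01J7]
-/

-- single-problem summit: the doubled namespace component is forced
set_option linter.dupNamespace false

noncomputable section

universe u

namespace Summit.ResolutionOfSingularities.ResolutionOfSingularities.Theorems.FInjectiveMacaulayfication.AdmissibleLocalCentre

open CategoryTheory AlgebraicGeometry TopologicalSpace
open Literature.AlgebraicGeometry.Resolution

/-- **The regular locus of `Spec 𝒪_{X,x}` is the pull-back of the regular locus of `X`** along the flat preimmersion `X.fromSpecStalk x`.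
[folklore; cite: Temkin2008, §2.1] -/
theorem mem_regularLocus_Spec_stalk_iff {X : Scheme.{u}} (x : X) (s : Spec (X.presheaf.stalk x)) :
    s ∈ Scheme.regularLocus (Spec (X.presheaf.stalk x)) ↔ X.fromSpecStalk x s ∈ Scheme.regularLocus X := by
  haveI : Flat (X.fromSpecStalk x) := flat_fromSpecStalk X x
  exact mem_regularLocus_iff_of_flat_of_isPreimmersion (X.fromSpecStalk x) s

/-- **ADMISSIBILITY of the base-changed centre**: `Supp J ⊆ (Reg X)ᶜ` implies `Supp (J.comap (X.fromSpecStalk x)) ⊆ (Reg (Spec 𝒪_{X,x}))ᶜ`.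
[folklore; cite: Temkin2008, Prop. 2.3.4 (iii) (X_reg-admissible blow-ups)] -/
theorem support_comap_fromSpecStalk_subset {X : Scheme.{u}} (J : X.IdealSheafData)
    (hJ : (J.support : Set X) ⊆ (Scheme.regularLocus X)ᶜ) (x : X) :
    ((J.comap (X.fromSpecStalk x)).support : Set (Spec (X.presheaf.stalk x))) ⊆ (Scheme.regularLocus (Spec (X.presheaf.stalk x)))ᶜ := by
  intro s hs hreg
  rw [Scheme.IdealSheafData.support_comap] at hs
  exact hJ hs ((mem_regularLocus_Spec_stalk_iff x s).mp hreg)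

/-- The same for any morphism that is a flat preimmersion (e.g. the pro-open projections of the «LD» inductions). [folklore] -/
theorem support_comap_subset_of_flat_of_isPreimmersion {X Y : Scheme.{u}} (f : X ⟶ Y) [Flat f] [IsPreimmersion f] (J : Y.IdealSheafData)
    (hJ : (J.support : Set Y) ⊆ (Scheme.regularLocus Y)ᶜ) :
    ((J.comap f).support : Set X) ⊆ (Scheme.regularLocus X)ᶜ := by
  intro s hs hreg
  rw [Scheme.IdealSheafData.support_comap] at hs
  exact hJ hs ((mem_regularLocus_iff_of_flat_of_isPreimmersion f s).mp hreg)

end Summit.ResolutionOfSingularities.ResolutionOfSingularities.Theorems.FInjectiveMacaulayfication.AdmissibleLocalCentre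

end
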